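import Literature.Analysis.FluidPDE.KNSSNoAxisymmetricTypeIReduced
import Literature.Analysis.FluidPDE.LerayLocalRegularH1Proofs
import HarnessLib

/-!
# Continuation of bounded Leray–Hopf solutions past the final time (Robinson–Rodrigo–Sadowski 2016, Thm. 8.17) — discharged

Analysis/FluidPDE glue file **discharging the named fact
`Literature.Analysis.FluidPDE.hasSmoothExtensionPast_of_bounded`** (`KNSSTypeII.lean`; J. C.
Robinson, J. L. Rodrigo, W. Sadowski, *The Three-Dimensional Navier–Stokes Equations*, CUP 2016,
Thm. 8.17 in the Serrin class `L²(0, T; L^∞)` with Thms. 6.15, 6.10, 7.5: a Leray–Hopf solution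
bounded up to the final time extends smoothly past it). The accepted tree reduction is
`hasSmoothExtensionPast_of_bounded_of_leray_regular` (`KNSSNoAxisymmetricTypeIReduced.lean`, from
the local `H¹` regularity theorem for Leray–Hopf solutions), and that theorem is discharged
(`leray_local_regular_H1_holds`, `LerayLocalRegularH1Proofs.lean`).

Theorem-only glue module: no definitions, no named facts, no `sorry`; each theorem is a
composition of an accepted tree reduction with accepted discharges (pure proof of an
unchanged statement).

## References

* J. C. Robinson, J. L. Rodrigo, W. Sadowski, *The Three-Dimensional Navier–Stokes Equations*,
  CUP (2016), Thm. 8.17 (PDF p. 131), Thms. 6.15, 6.10, 7.5. [RobinsonRodrigoSadowski2016]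
* G. Koch, N. Nadirashvili, G. Seregin, V. Šverák, *Liouville theorems for the Navier–Stokes
  equations and applications*, Acta Math. 203 (2009), §1 (type II blow-up). [KNSS2009]
-/

noncomputable section

namespace Literature.Analysis.FluidPDE

/-- **Robinson–Rodrigo–Sadowski 2016, Thm. 8.17 (continuation of bounded Leray–Hopf solutions),
proved** (the named statement `hasSmoothExtensionPast_of_bounded`), by
`hasSmoothExtensionPast_of_bounded_of_leray_regular` and `leray_local_regular_H1_holds`. [cite: RobinsonRodrigoSadowski2016, Thm 8.17 (r = 2, s = ∞; PDF p. 131) with Thms 6.15, 6.10, 7.5] -/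
theorem hasSmoothExtensionPast_of_bounded_holds : hasSmoothExtensionPast_of_bounded :=
  hasSmoothExtensionPast_of_bounded_of_leray_regular leray_local_regular_H1_holds

end Literature.Analysis.FluidPDE
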